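import Summits.SmoothPoincare4.SmoothPoincare4.Theorems.ConvexBisectionAcyclicBisectionExistsPageTwistingTransverse
import HarnessLib

/-!
# N3 (`stub_STgeo`) ▸ N3-nat ▸ N3d-1 ▸ G1d: THE POINTWISE ALGEBRA OF TWISTING TRANSPORT ACROSS GENERA
(wave 7, brick H6-8 of stub `stub_STgeo` = node N3 of NF4, line `modp-braid-orbits`, crux
`ConvexBisection.AcyclicBisectionExists`, item stmt-SmoothPoincare4-10508; registered sub-goal
`helper_twistPair_transport`; design file `work/design/N3_Stabilisation_Design.lean` (G5, wave 6),
clause `twisting_transport` of `StabBaseData` (`…StabilisationData.lean`, H6-1), split G1d.)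

Clause `twisting_transport` of the stabilised base data says that the fibred 1-handle identification
`E.jA : Base g ⇀ Base (g+1)` carries the page twisting of a framed embedded page curve to the page
twisting of the pushed-forward framing of the image curve.  The landed transport theorem
`pageTwisting_transport_eq_of_fibred` (p132432) is for ambient isotopies of ONE base and does not apply
across genera; the right tool is X3's landed pointwise criterion `wind_eq_of_pointwise_frame`
(`…SeamTwistSign.lean`): two closed loops `ℓ, ℓ' : ℝ → ℂ` have `wind ℓ' = s₀ · wind ℓ` as soon as,
pointwise, `im ℓ' = κ · im ℓ` with `κ > 0` and, where `im ℓ = 0`, `re ℓ' = b · re ℓ` with `s₀ b > 0`.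
This file supplies those two pointwise relations for the twisting pairs
`ℓ = (⟪V, iT⟫, ⟪V, n_g(q)⟫)` and `ℓ' = (⟪L V, i LT⟫, ⟪L V, n_{g'}(q')⟫)` of a framed page curve and of
its image under a map with AMBIENT DIFFERENTIAL `L` at `q ↦ q'` which is FIBRED there
(`w_{g'}(q') = w_g(q)` and `dΦ_{g'} ∘ L = dΦ_g`, `Φ = w + 1`) and complex-orientation-preserving on the
page line (`L(iT) = μ · LT` on `ℂ²` with `Im μ > 0`) — pure linear algebra in `ℂ² = ℝ⁴` over the Hermitian
bookkeeping of `…PageTwistingTransverse.lean` (X-wave: `inner_horizNormal`, `inner_cplxJ`, `ext_cx_cy`):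

* `inner_horizNormal_transport` — **`⟪L V, n'(q')⟫ = (N_q/N_{q'}) · ⟪V, n(q)⟫`** (`N = ‖dΦ‖²`), for EVERY
  `V` (from fibredness alone: `⟪u, n(q)⟫ = Im (w̄ dΦ_q u)/N_q`);
* `inner_cplxJ_transport` — **where `⟪V, n(q)⟫ = 0` (and `V` is tangent to `∂`, `Re (w̄ dΦ V) = 0`):
  `⟪L V, i LT⟫ = (Im μ · ‖LT‖²/‖T‖²) · ⟪V, iT⟫`** (`V ∈ ker dΦ = ℂ·T`, `V = aT + b iT`, `LV = a LT + b L(iT)`);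
* `twistPair_transport` / registered `helper_twistPair_transport` — both, in the shape of the hypotheses
  `hP` of `wind_eq_of_pointwise_frame` with `s₀ = 1`.

Everything is proved; no definitions.  References: J. B. Etnyre, T. Fuller, IMRN 2006, §2 (the page
framing) [EtnyreFuller2006]; R. E. Gompf, A. I. Stipsicz, *4-Manifolds and Kirby Calculus* (1999), §8.2
[GompfStipsicz1999].
-/

noncomputable section

-- the prescribed namespace `Summit.<P>.<Sub>.…` duplicates `SmoothPoincare4` (P = Sub)
set_option linter.dupNamespace false

open scoped ComplexConjugate
open Set Function

namespace Summit.SmoothPoincare4.SmoothPoincare4.Theorems.AcyclicBisectionExists.ModpBraidOrbits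

open Literature.Topology.FourManifolds Literature.Topology.FourManifolds.LefschetzBase

namespace StabTwistTransport

variable {g g' : ℕ}

/-! ## §1 The normal component: fibredness alone -/

/-- **Transport of the normal component of the twisting pair**: if `L` is fibred at `q ↦ q'`
(`w_{g'}(q') = w_g(q)`, `dΦ_{g'}(L u) = dΦ_g(u)` for all `u`), then `⟪L V, n'(q')⟫ = (N_q/N_{q'}) ⟪V, n(q)⟫`
with `N = ‖dΦ_X‖² + ‖dΦ_Y‖² > 0`. [folklore] -/
theorem inner_horizNormal_transport {q q' : EuclideanSpace ℝ (Fin 4)} (hq : q ≠ 0) (hq' : q' ≠ 0)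
    (L : EuclideanSpace ℝ (Fin 4) →ₗ[ℝ] EuclideanSpace ℝ (Fin 4)) (hw : w g' q' = w g q)
    (hdΦ : ∀ u, dPhiX g' q' * cx (L u) + dPhiY q' * cy (L u) = dPhiX g q * cx u + dPhiY q * cy u)
    (V : EuclideanSpace ℝ (Fin 4)) :
    inner ℝ (L V) (horizNormal g' q') =
      (‖dPhiX g q‖ ^ 2 + ‖dPhiY q‖ ^ 2) / (‖dPhiX g' q'‖ ^ 2 + ‖dPhiY q'‖ ^ 2) *
        inner ℝ V (horizNormal g q) := by
  have hN : ‖dPhiX g q‖ ^ 2 + ‖dPhiY q‖ ^ 2 ≠ 0 := normSq_dPhi_ne_zero hq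
  have hN' : ‖dPhiX g' q'‖ ^ 2 + ‖dPhiY q'‖ ^ 2 ≠ 0 := normSq_dPhi_ne_zero hq'
  rw [inner_horizNormal, inner_horizNormal, hdΦ V, hw]
  field_simp

/-- The normal-component factor is positive. [folklore] -/
theorem normFactor_pos {q q' : EuclideanSpace ℝ (Fin 4)} (hq : q ≠ 0) (hq' : q' ≠ 0) :
    0 < (‖dPhiX g q‖ ^ 2 + ‖dPhiY q‖ ^ 2) / (‖dPhiX g' q'‖ ^ 2 + ‖dPhiY q'‖ ^ 2) :=
  div_pos (lt_of_le_of_ne (by positivity) (normSq_dPhi_ne_zero hq).symm)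
    (lt_of_le_of_ne (by positivity) (normSq_dPhi_ne_zero hq').symm)

/-! ## §2 The in-page component where the normal component vanishes -/

/-- A vector in the page line `ker dΦ_q = ℂ · T` (`T ≠ 0` in the line) is `a T + b iT`: explicitly
`‖T‖² V = (Re H) T + (Im H) iT` with `H = ⟨V, T⟩_Herm`. [folklore] -/
theorem eq_smul_add_smul_cplxJ_of_dPhi_eq_zero {q V T : EuclideanSpace ℝ (Fin 4)} (hq : q ≠ 0) (hT : T ≠ 0)
    (hTL : dPhiX g q * cx T + dPhiY q * cy T = 0) (hVL : dPhiX g q * cx V + dPhiY q * cy V = 0) :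
    V = ((cx V * conj (cx T) + cy V * conj (cy T)).re / ‖T‖ ^ 2) • T +
      ((cx V * conj (cx T) + cy V * conj (cy T)).im / ‖T‖ ^ 2) • cplxJ T := by
  -- `V` and `T` are `ℂ`-collinear: the `2 × 2` determinant vanishes
  have hdet : cx V * cy T - cx T * cy V = 0 := by
    rcases dPhiX_ne_zero_or (g := g) hq with ha | hb
    · have : dPhiX g q * (cx V * cy T - cx T * cy V) = dPhiX g q * 0 := by
        linear_combination (cy T) * hVL - (cy V) * hTL
      exact mul_left_cancel₀ ha this
    · have : dPhiY q * (cx V * cy T - cx T * cy V) = dPhiY q * 0 := by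
        linear_combination (cx V) * hTL - (cx T) * hVL
      exact mul_left_cancel₀ hb this
  set H : ℂ := cx V * conj (cx T) + cy V * conj (cy T) with hH
  have hm : (0 : ℝ) < ‖T‖ ^ 2 := by positivity
  have hmC := ofReal_norm_sq_eq T
  have hx : ((‖T‖ ^ 2 : ℝ) : ℂ) * cx V = H * cx T := by
    rw [hmC, hH]; linear_combination (conj (cy T)) * hdet
  have hy : ((‖T‖ ^ 2 : ℝ) : ℂ) * cy V = H * cy T := by
    rw [hmC, hH]; linear_combination (-(conj (cx T))) * hdet
  have hHsplit : ((H.re : ℝ) : ℂ) + ((H.im : ℝ) : ℂ) * Complex.I = H := Complex.re_add_im H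
  have hm0 : ((‖T‖ ^ 2 : ℝ) : ℂ) ≠ 0 := by exact_mod_cast hm.ne'
  refine ext_cx_cy ?_ ?_
  · rw [cx_add, cx_smul, cx_smul, cx_cplxJ, Complex.ofReal_div, Complex.ofReal_div]
    field_simp
    linear_combination hx - (cx T) * hHsplit
  · rw [cy_add, cy_smul, cy_smul, cy_cplxJ, Complex.ofReal_div, Complex.ofReal_div]
    field_simp
    linear_combination hy - (cy T) * hHsplit

/-- The Hermitian square of a vector is `‖·‖²` (real). [folklore] -/
theorem herm_self_eq (T : EuclideanSpace ℝ (Fin 4)) :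
    cx T * conj (cx T) + cy T * conj (cy T) = ((‖T‖ ^ 2 : ℝ) : ℂ) := (ofReal_norm_sq_eq T).symm

/-- **Transport of the in-page component where the normal component vanishes.**  Let `T ≠ 0` span the
page line at `q ≠ 0` (`dΦ_q T = 0`, `w_g q ≠ 0`), `V` tangent to `∂` (`Re (w̄ dΦ_q V) = 0`) with
`⟪V, n(q)⟫ = 0`, and let the real-linear `L` act on the page line as multiplication by `μ ∈ ℂ` followed by
`T ↦ LT` (`L (iT) = μ · LT` in `ℂ²`).  Then `⟪L V, i (LT)⟫ = (Im μ · ‖LT‖² / ‖T‖²) · ⟪V, iT⟫`. [folklore] -/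
theorem inner_cplxJ_transport {q V T : EuclideanSpace ℝ (Fin 4)} (hq : q ≠ 0) (hw0 : w g q ≠ 0) (hT : T ≠ 0)
    (hTL : dPhiX g q * cx T + dPhiY q * cy T = 0)
    (hVt : (conj (w g q) * (dPhiX g q * cx V + dPhiY q * cy V)).re = 0)
    (hVn : inner ℝ V (horizNormal g q) = 0)
    (L : EuclideanSpace ℝ (Fin 4) →ₗ[ℝ] EuclideanSpace ℝ (Fin 4)) {μ : ℂ}
    (hLx : cx (L (cplxJ T)) = μ * cx (L T)) (hLy : cy (L (cplxJ T)) = μ * cy (L T)) :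
    inner ℝ (L V) (cplxJ (L T)) = μ.im * ‖L T‖ ^ 2 / ‖T‖ ^ 2 * inner ℝ V (cplxJ T) := by
  have hN : ‖dPhiX g q‖ ^ 2 + ‖dPhiY q‖ ^ 2 ≠ 0 := normSq_dPhi_ne_zero hq
  -- `dΦ(V) = 0`
  rw [inner_horizNormal, div_eq_zero_iff] at hVn
  have him : (conj (w g q) * (dPhiX g q * cx V + dPhiY q * cy V)).im = 0 := hVn.resolve_right hN
  have hD : conj (w g q) * (dPhiX g q * cx V + dPhiY q * cy V) = 0 :=
    Complex.ext (by rw [hVt, Complex.zero_re]) (by rw [him, Complex.zero_im])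
  have hVL : dPhiX g q * cx V + dPhiY q * cy V = 0 :=
    (mul_eq_zero.1 hD).resolve_left ((map_ne_zero _).2 hw0)
  -- `V = a T + b iT`, so `L V = a LT + b L(iT)`
  set H : ℂ := cx V * conj (cx T) + cy V * conj (cy T) with hH
  set a : ℝ := H.re / ‖T‖ ^ 2 with ha
  set b : ℝ := H.im / ‖T‖ ^ 2 with hb
  have hV : V = a • T + b • cplxJ T := eq_smul_add_smul_cplxJ_of_dPhi_eq_zero hq hT hTL hVL
  have hLV : L V = a • L T + b • L (cplxJ T) := by
    conv_lhs => rw [hV]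
    rw [map_add, map_smul, map_smul]
  have hm : (0 : ℝ) < ‖T‖ ^ 2 := by positivity
  -- the two inner products through the Hermitian bookkeeping
  have h1 : inner ℝ V (cplxJ T) = b * ‖T‖ ^ 2 := by
    rw [inner_cplxJ, ← hH, hb]; field_simp
  have h2 : inner ℝ (L V) (cplxJ (L T)) = b * μ.im * ‖L T‖ ^ 2 := by
    rw [inner_cplxJ, hLV, cx_add, cy_add, cx_smul, cx_smul, cy_smul, cy_smul, hLx, hLy]
    have e : ((a : ℂ) * cx (L T) + (b : ℂ) * (μ * cx (L T))) * conj (cx (L T)) +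
        ((a : ℂ) * cy (L T) + (b : ℂ) * (μ * cy (L T))) * conj (cy (L T)) =
        ((a : ℂ) + (b : ℂ) * μ) * ((‖L T‖ ^ 2 : ℝ) : ℂ) := by
      rw [← herm_self_eq]; ring
    rw [e]
    simp only [Complex.mul_im, Complex.add_re, Complex.add_im, Complex.ofReal_re, Complex.ofReal_im,
      Complex.mul_re, zero_mul, sub_zero, add_zero, zero_add, mul_zero]
  rw [h1, h2]
  field_simp

/-! ## §3 Both relations, in the shape of `wind_eq_of_pointwise_frame` -/

/-- **The pointwise twisting-transport relations** (`twistPair_transport`): under fibredness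
(`w' = w`, `dΦ' ∘ L = dΦ`), tangency of `V` and complex-orientation-preservation of `L` on the page line
(`L(iT) = μ · LT`, `Im μ > 0`, `LT ≠ 0`): `∃ κ > 0, ⟪LV, n'⟫ = κ ⟪V, n⟫`, and
`⟪V, n⟫ = 0 → ∃ b, 0 < 1 · b ∧ ⟪LV, i LT⟫ = b ⟪V, iT⟫` — the hypotheses `hP` of X3's
`wind_eq_of_pointwise_frame` with `s₀ = 1`, for the twisting loops of a framed page curve and of its image
under a fibred, page-orientation-preserving smooth map read through its ambient differential.
[cite: EtnyreFuller2006, §2] -/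
theorem twistPair_transport {q q' V T : EuclideanSpace ℝ (Fin 4)} (hq : q ≠ 0) (hq' : q' ≠ 0)
    (hw0 : w g q ≠ 0) (hT : T ≠ 0) (hTL : dPhiX g q * cx T + dPhiY q * cy T = 0)
    (hVt : (conj (w g q) * (dPhiX g q * cx V + dPhiY q * cy V)).re = 0)
    (L : EuclideanSpace ℝ (Fin 4) →ₗ[ℝ] EuclideanSpace ℝ (Fin 4)) (hw : w g' q' = w g q)
    (hdΦ : ∀ u, dPhiX g' q' * cx (L u) + dPhiY q' * cy (L u) = dPhiX g q * cx u + dPhiY q * cy u)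
    {μ : ℂ} (hμ : 0 < μ.im) (hLT : L T ≠ 0)
    (hLx : cx (L (cplxJ T)) = μ * cx (L T)) (hLy : cy (L (cplxJ T)) = μ * cy (L T)) :
    (∃ κ : ℝ, 0 < κ ∧ inner ℝ (L V) (horizNormal g' q') = κ * inner ℝ V (horizNormal g q)) ∧
    (inner ℝ V (horizNormal g q) = 0 → ∃ b : ℝ, 0 < (1 : ℝ) * b ∧
      inner ℝ (L V) (cplxJ (L T)) = b * inner ℝ V (cplxJ T)) := by
  refine ⟨⟨_, normFactor_pos hq hq', inner_horizNormal_transport hq hq' L hw hdΦ V⟩, fun hVn => ?_⟩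
  refine ⟨μ.im * ‖L T‖ ^ 2 / ‖T‖ ^ 2, ?_, inner_cplxJ_transport hq hw0 hT hTL hVt hVn L hLx hLy⟩
  rw [one_mul]
  have h1 : (0 : ℝ) < ‖L T‖ ^ 2 := by positivity
  have h2 : (0 : ℝ) < ‖T‖ ^ 2 := by positivity
  positivity

end StabTwistTransport

/-! ## Registered helper -/

/-- **Registered helper `helper_twistPair_transport` (sub-goal of `stub_STgeo` ▸ N3-nat ▸ N3d-1 ▸ G1d
`twisting_transport`, wave 7, lead c5): the pointwise twisting-transport relations across genera (normal
component by fibredness, in-page component by complex-orientation preservation on the page line), in the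
shape consumed by `wind_eq_of_pointwise_frame`.** [cite: EtnyreFuller2006, §2] -/
theorem helper_twistPair_transport : ∀ (g g' : ℕ) (q q' V T : EuclideanSpace ℝ (Fin 4)), q ≠ 0 → q' ≠ 0 → Literature.Topology.FourManifolds.LefschetzBase.w g q ≠ 0 → T ≠ 0 → Literature.Topology.FourManifolds.LefschetzBase.dPhiX g q * Literature.Topology.FourManifolds.LefschetzBase.cx T + Literature.Topology.FourManifolds.LefschetzBase.dPhiY q * Literature.Topology.FourManifolds.LefschetzBase.cy T = 0 → ((starRingEnd ℂ) (Literature.Topology.FourManifolds.LefschetzBase.w g q) * (Literature.Topology.FourManifolds.LefschetzBase.dPhiX g q * Literature.Topology.FourManifolds.LefschetzBase.cx V + Literature.Topology.FourManifolds.LefschetzBase.dPhiY q * Literature.Topology.FourManifolds.LefschetzBase.cy V)).re = 0 → ∀ (L : EuclideanSpace ℝ (Fin 4) →ₗ[ℝ] EuclideanSpace ℝ (Fin 4)), Literature.Topology.FourManifolds.LefschetzBase.w g' q' = Literature.Topology.FourManifolds.LefschetzBase.w g q → (∀ u, Literature.Topology.FourManifolds.LefschetzBase.dPhiX g' q' *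 Literature.Topology.FourManifolds.LefschetzBase.cx (L u) + Literature.Topology.FourManifolds.LefschetzBase.dPhiY q' * Literature.Topology.FourManifolds.LefschetzBase.cy (L u) = Literature.Topology.FourManifolds.LefschetzBase.dPhiX g q * Literature.Topology.FourManifolds.LefschetzBase.cx u + Literature.Topology.FourManifolds.LefschetzBase.dPhiY q * Literature.Topology.FourManifolds.LefschetzBase.cy u) → ∀ (μ : ℂ), 0 < μ.im → L T ≠ 0 → Literature.Topology.FourManifolds.LefschetzBase.cx (L (Literature.Topology.FourManifolds.LefschetzBase.cplxJ T)) = μ * Literature.Topology.FourManifolds.LefschetzBase.cx (L T) → Literature.Topology.FourManifolds.LefschetzBase.cy (L (Literature.Topology.FourManifolds.LefschetzBase.cplxJ T)) = μ * Literature.Topology.FourManifolds.LefschetzBase.cy (L T) → (∃ κ : ℝ, 0 < κ ∧ inner ℝ (L V) (Literature.Topology.FourManifolds.LefschetzBase.horizNormal g' q') = κ * inner ℝ V (Literature.Topology.FourManifolds.LefschetzBase.horizNormal g q)) ∧ (inner ℝ V (Literature.Topology.FourManifolds.LefschetzBase.horizNormal g q) = 0 → ∃ b : ℝ, 0 < (1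 : ℝ) * b ∧ inner ℝ (L V) (Literature.Topology.FourManifolds.LefschetzBase.cplxJ (L T)) = b * inner ℝ V (Literature.Topology.FourManifolds.LefschetzBase.cplxJ T)) :=
  fun _ _ _ _ _ _ hq hq' hw0 hT hTL hVt L hw hdΦ _ hμ hLT hLx hLy =>
    StabTwistTransport.twistPair_transport hq hq' hw0 hT hTL hVt L hw hdΦ hμ hLT hLx hLy

end Summit.SmoothPoincare4.SmoothPoincare4.Theorems.AcyclicBisectionExists.ModpBraidOrbits

end
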